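import Summits.AnomalousDissipation.AnomalousDissipation.Theorems.SawtoothPulseCascadeK1LocalisedCascadeKoopmanLeakage
import Summits.AnomalousDissipation.AnomalousDissipation.Theorems.SawtoothPulseCascadeK1LocalisedCascadeSlotFibreSum

/-!
# K1loc, line `Spectral` / SeqCone — helper: THE PER-FIBRE ESTIMATE UNDER A FACTORISED SHEAR (S-B assembly, step 1)

Helper file of the prover lane on the crux `K1LocalisedCascade` (stmt-AnomalousDissipation-19491), route
`SawtoothPulseCascade` (memo v6 §2b; companion of `…K1LocalisedCascadeLedgerStep`).  After `…LedgerGlue[V]` one analytic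
input per strip family and half-slot remains for the energy ledger: the abstract per-fibre un-gauging estimate `hfib` of
`…K1Slot.sqrt_tsum_symbol_sq_family_step_H/_V`, for the TRUE cascade profile `U_j`:
  `∀ n G, G smooth on the fibre k_i = n →
     Σ m²|𝓕(Ξ · G∘Φ_R)|² ≤ (√Σ μ²|𝓕G|² + A‖G‖)² + 2C‖G‖²`,            `Φ_R = shearMap i j R`, `R = γU_j`.
The un-gauging bricks (`…SlotFibreMax`, `…SlotMultiplierData`) want EXACT slopes on the strips, which the Gaussian-rounded
`U_j` does not have; the repair of memo v6 §2b is the factorisation `U_j = Ũ_j + (U_j − Ũ_j)` (`Ũ_j` affine on the strips,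
`…AffineProfileCascade`), i.e. `Φ_R = Φ_P ∘ Φ_Q` with `P = γŨ_j`, `Q = γ(U_j − Ũ_j)` (shears along one axis add), and a
Koopman-leakage bound for the tiny residual shear `Φ_Q` on the tracked fibres.  This file is that assembly step, abstract in
the profiles:
* `shearMap_shearMap_of_add` — `Φ_P (Φ_Q x) = Φ_R x` when `R = P + Q` pointwise (same axis, same driving coordinate);
* `fibre_estimate_of_symbol_eq_one` — on a fibre where the OLD symbol is `≡ 1` the estimate holds trivially for any
  `A, C ≥ 0` (`|m| ≤ 1`, `‖Ξ‖ ≤ 1`, measure-preserving shear, Parseval) — the fibres beyond the envelope radius;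
* `fibre_estimate_of_factor` — the estimate for `Φ_R` on a fibre from the estimate for `Φ_P` (applied to `G∘Φ_Q`, which
  stays on the fibre) and a leakage bound `√Σ μ²|𝓕(G∘Φ_Q)|² ≤ √Σ μ²|𝓕G|² + A_Q‖G‖`: constants `(A + A_Q, C)`;
* `fibre_estimate_of_factor_of_moduli` — the same with the leakage bound discharged by
  `…SpectralLeakage.sqrt_tsum_symbol_sq_comp_shearMap_fibre_le` (first-order modulus `ω` of `μ` against the spectrum of the
  residual phase `x ↦ e^{−2πi n Q(x_j)}`), and `fibre_estimate_of_split` — the two cases glued along a radius `R₀`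
  (`μ ≡ 1` on the fibres `|n| ≥ R₀`).
No definitions; no statement about the stub.
[cite: Grafakos2014, Prop. 3.1.2 (5) and Prop. 3.2.7 (3)] [problem: turb]
-/

-- `Summit.<Summit>.<Problem>`: single-conjunct summit, the duplicate namespace segment is deliberate.
set_option linter.dupNamespace false

noncomputable section

namespace Summit.AnomalousDissipation.AnomalousDissipation.Theorems.SawtoothPulseCascade.K1Ledger

open MeasureTheory Set Filter Topology UnitAddTorus Function Complex
open Literature.Analysis Literature.Analysis.FunctionSpaces Literature.Analysis.FunctionSpaces.Torus
open Summit.AnomalousDissipation.AnomalousDissipation.Theorems.SawtoothPulseCascade.SpectralLeakage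
open Summit.AnomalousDissipation.AnomalousDissipation.Theorems.SawtoothPulseCascade.K1Slot

variable {d : Type*} [Fintype d] [DecidableEq d]

/-! ## §1 Shears along one axis add -/

omit [Fintype d] in
/-- **Shears along one axis add**: if `R = P + Q` pointwise then `Φ_P (Φ_Q x) = Φ_R x` (same displaced axis `i`, same
driving coordinate `j ≠ i`, which both shears leave unchanged). [folklore] -/
theorem shearMap_shearMap_of_add {i j : d} (hij : i ≠ j) (P Q R : ShearProfile) (hR : ∀ y, R y = P y + Q y)
    (x : UnitAddTorus d) : shearMap i j P (shearMap i j Q x) = shearMap i j R x := by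
  have hj : shearMap i j Q x j = x j := shearMap_apply_of_ne Q x hij.symm
  obtain ⟨y, hy⟩ := QuotientAddGroup.mk_surjective (x j)
  rw [shearMap_apply, hj, shearMap_apply, shearMap_apply, sub_sub, ← Pi.single_add, ← hy, ShearProfile.onCircle_coe,
    ShearProfile.onCircle_coe, ShearProfile.onCircle_coe, hR y, add_comm (P y)]
  rfl

/-! ## §2 Fibres on which the old symbol is `≡ 1` -/

/-- **Trivial fibres.**  If the old symbol `μ` equals `1` on the fibre `k_i = n`, `|m| ≤ 1` and `‖Ξ‖ ≤ 1` (continuous),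
then for every smooth `G` on that fibre and every profile `R`:
`Σ m²|𝓕(Ξ·G∘Φ_R)|² ≤ Σ μ²|𝓕G|² ≤ (√Σ μ²|𝓕G|² + A‖G‖)² + 2C‖G‖²` for any `A, C ≥ 0` (Parseval; the shear preserves the
`L²` norm). [cite: Grafakos2014, Prop. 3.2.7 (3)] -/
theorem fibre_estimate_of_symbol_eq_one {i j : Fin 2} (hij : i ≠ j) (R : ShearProfile) {Ξ : UnitAddTorus (Fin 2) → ℂ}
    (hΞ : Continuous Ξ) (hΞ1 : ∀ x, ‖Ξ x‖ ≤ 1) {m μ : (Fin 2 → ℤ) → ℝ} (hm1 : ∀ k, |m k| ≤ 1)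
    {n : ℤ} (hμn : ∀ k : Fin 2 → ℤ, k i = n → μ k = 1) {A C : ℝ} (hA : 0 ≤ A) (hC : 0 ≤ C)
    {G : UnitAddTorus (Fin 2) → ℂ} (hG : IsSmooth G) (hn : ∀ k, mFourierCoeff G k ≠ 0 → k i = n) :
    ∑' k, m k ^ 2 * ‖mFourierCoeff (fun x => Ξ x * G (shearMap i j R x)) k‖ ^ 2 ≤
      (Real.sqrt (∑' k, μ k ^ 2 * ‖mFourierCoeff G k‖ ^ 2) + A * Real.sqrt (∫ x, ‖G x‖ ^ 2)) ^ 2 +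
        2 * C * ∫ x, ‖G x‖ ^ 2 := by
  have hGR : IsSmooth (G ∘ shearMap i j R) := hG.comp_shearMap i j R
  have hHc : Continuous fun x => Ξ x * G (shearMap i j R x) := hΞ.mul hGR.continuous
  -- Parseval for the product and the bound `|m| ≤ 1`, `‖Ξ‖ ≤ 1`
  have hP := hasSum_sq_mFourierCoeff_of_continuous hHc
  have h1 : ∑' k, m k ^ 2 * ‖mFourierCoeff (fun x => Ξ x * G (shearMap i j R x)) k‖ ^ 2 ≤
      ∫ x, ‖Ξ x * G (shearMap i j R x)‖ ^ 2 := by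
    rw [← hP.tsum_eq]
    refine Summable.tsum_le_tsum (fun k => ?_) ?_ hP.summable
    · have hmk : m k ^ 2 ≤ 1 := by
        have := hm1 k; rw [← sq_abs]; nlinarith [abs_nonneg (m k)]
      calc m k ^ 2 * ‖mFourierCoeff (fun x => Ξ x * G (shearMap i j R x)) k‖ ^ 2
          ≤ 1 * ‖mFourierCoeff (fun x => Ξ x * G (shearMap i j R x)) k‖ ^ 2 :=
            mul_le_mul_of_nonneg_right hmk (sq_nonneg _)
        _ = _ := one_mul _
    · exact (hP.summable.mul_left 1).of_nonneg_of_le (fun k => by positivity) fun k => by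
        have hmk : m k ^ 2 ≤ 1 := by
          have := hm1 k; rw [← sq_abs]; nlinarith [abs_nonneg (m k)]
        exact mul_le_mul_of_nonneg_right hmk (sq_nonneg _)
  have h2 : ∫ x, ‖Ξ x * G (shearMap i j R x)‖ ^ 2 ≤ ∫ x, ‖G (shearMap i j R x)‖ ^ 2 := by
    refine integral_mono (hHc.norm.pow 2).integrable_unitAddTorus (hGR.continuous.norm.pow 2).integrable_unitAddTorus
      fun x => ?_
    simp only [norm_mul]
    have h0 : 0 ≤ ‖G (shearMap i j R x)‖ := norm_nonneg _
    calc (‖Ξ x‖ * ‖G (shearMap i j R x)‖) ^ 2 ≤ (1 * ‖G (shearMap i j R x)‖) ^ 2 :=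
          pow_le_pow_left₀ (by positivity) (mul_le_mul_of_nonneg_right (hΞ1 x) h0) 2
      _ = ‖G (shearMap i j R x)‖ ^ 2 := by rw [one_mul]
  have h3 : ∫ x, ‖G (shearMap i j R x)‖ ^ 2 = ∫ x, ‖G x‖ ^ 2 := integral_comp_shearMap hij R (fun x => ‖G x‖ ^ 2)
  -- Parseval for `G` and `μ = 1` on its spectrum
  have hPG := hasSum_sq_mFourierCoeff_of_continuous hG.continuous
  have h4 : ∫ x, ‖G x‖ ^ 2 = ∑' k, μ k ^ 2 * ‖mFourierCoeff G k‖ ^ 2 := by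
    rw [← hPG.tsum_eq]
    refine tsum_congr fun k => ?_
    by_cases hk : mFourierCoeff G k = 0
    · simp [hk]
    · rw [hμn k (hn k hk), one_pow, one_mul]
  have h5 : 0 ≤ ∑' k, μ k ^ 2 * ‖mFourierCoeff G k‖ ^ 2 := tsum_nonneg fun k => by positivity
  have h6 : ∑' k, μ k ^ 2 * ‖mFourierCoeff G k‖ ^ 2 ≤
      (Real.sqrt (∑' k, μ k ^ 2 * ‖mFourierCoeff G k‖ ^ 2) + A * Real.sqrt (∫ x, ‖G x‖ ^ 2)) ^ 2 +
        2 * C * ∫ x, ‖G x‖ ^ 2 := by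
    have hs : Real.sqrt (∑' k, μ k ^ 2 * ‖mFourierCoeff G k‖ ^ 2) ^ 2 = ∑' k, μ k ^ 2 * ‖mFourierCoeff G k‖ ^ 2 :=
      Real.sq_sqrt h5
    have hI : 0 ≤ ∫ x, ‖G x‖ ^ 2 := integral_nonneg fun x => by positivity
    nlinarith [Real.sqrt_nonneg (∑' k, μ k ^ 2 * ‖mFourierCoeff G k‖ ^ 2), Real.sqrt_nonneg (∫ x, ‖G x‖ ^ 2),
      mul_nonneg hA (Real.sqrt_nonneg (∫ x, ‖G x‖ ^ 2)), mul_nonneg hC hI]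
  linarith [h1, h2, h3.le, h4.le]

/-! ## §3 The estimate under a factorised shear -/

/-- **Factorised shear.**  Let `R = P + Q` pointwise (profiles on the driving coordinate `x_j`, displaced axis `i ≠ j`), `G`
smooth on the fibre `k_i = n`.  If the per-fibre estimate holds for `Φ_P` on that fibre (for every smooth `G'` on it, constants
`A, C`) and the residual shear leaks at most `A_Q`: `√Σ μ²|𝓕(G∘Φ_Q)|² ≤ √Σ μ²|𝓕G|² + A_Q‖G‖`, then the estimate holds for
`Φ_R` with constants `(A + A_Q, C)` — because `G∘Φ_R = (G∘Φ_Q)∘Φ_P`, `G∘Φ_Q` stays on the fibre and has the same `L²` norm.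
[cite: Grafakos2014, Prop. 3.1.2 (5) and Prop. 3.2.7 (3)] -/
theorem fibre_estimate_of_factor {i j : Fin 2} (hij : i ≠ j) (P Q R : ShearProfile) (hR : ∀ y, R y = P y + Q y)
    (Ξ : UnitAddTorus (Fin 2) → ℂ) {m μ : (Fin 2 → ℤ) → ℝ} {n : ℤ} {A AQ C : ℝ} (hA : 0 ≤ A)
    (hfibP : ∀ G' : UnitAddTorus (Fin 2) → ℂ, IsSmooth G' → (∀ k, mFourierCoeff G' k ≠ 0 → k i = n) →
      ∑' k, m k ^ 2 * ‖mFourierCoeff (fun x => Ξ x * G' (shearMap i j P x)) k‖ ^ 2 ≤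
        (Real.sqrt (∑' k, μ k ^ 2 * ‖mFourierCoeff G' k‖ ^ 2) + A * Real.sqrt (∫ x, ‖G' x‖ ^ 2)) ^ 2 +
          2 * C * ∫ x, ‖G' x‖ ^ 2)
    {G : UnitAddTorus (Fin 2) → ℂ} (hG : IsSmooth G) (hn : ∀ k, mFourierCoeff G k ≠ 0 → k i = n)
    (hleak : Real.sqrt (∑' k, μ k ^ 2 * ‖mFourierCoeff (G ∘ shearMap i j Q) k‖ ^ 2) ≤
      Real.sqrt (∑' k, μ k ^ 2 * ‖mFourierCoeff G k‖ ^ 2) + AQ * Real.sqrt (∫ x, ‖G x‖ ^ 2)) :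
    ∑' k, m k ^ 2 * ‖mFourierCoeff (fun x => Ξ x * G (shearMap i j R x)) k‖ ^ 2 ≤
      (Real.sqrt (∑' k, μ k ^ 2 * ‖mFourierCoeff G k‖ ^ 2) + (A + AQ) * Real.sqrt (∫ x, ‖G x‖ ^ 2)) ^ 2 +
        2 * C * ∫ x, ‖G x‖ ^ 2 := by
  set G' : UnitAddTorus (Fin 2) → ℂ := G ∘ shearMap i j Q with hG'
  have hG's : IsSmooth G' := hG.comp_shearMap i j Q
  -- `G'` stays on the fibre: `G' = twist Q n (x_j) · G`
  have hG'eq : G' = fun x => twist Q n (x j) * G x := comp_shearMap_eq_mul_of_fibre hG hn Q j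
  have hinv : ∀ (s : UnitAddCircle) (x : UnitAddTorus (Fin 2)),
      twist Q n ((x + Pi.single i s : UnitAddTorus (Fin 2)) j) = twist Q n (x j) := fun s x => by
    have hx : (x + Pi.single i s : UnitAddTorus (Fin 2)) j = x j := by
      rw [Pi.add_apply, Pi.single_eq_of_ne hij.symm, add_zero]
    rw [hx]
  have hn' : ∀ k, mFourierCoeff G' k ≠ 0 → k i = n := by
    intro k hk
    by_contra hki
    have h0 := mFourierCoeff_mul_eq_zero_of_fibre (Ξ := fun x : UnitAddTorus (Fin 2) => twist Q n (x j)) hinv hG hn hki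
    rw [hG'eq] at hk
    exact hk h0
  -- `G∘Φ_R = G'∘Φ_P`
  have hcomp : (fun x => Ξ x * G (shearMap i j R x)) = fun x => Ξ x * G' (shearMap i j P x) := by
    funext x
    simp only [hG', Function.comp_apply]
    rw [shearMap_shearMap_of_add hij Q P R (fun y => (hR y).trans (add_comm _ _))]
  -- same `L²` norm
  have hL2 : ∫ x, ‖G' x‖ ^ 2 = ∫ x, ‖G x‖ ^ 2 := by
    simp only [hG', Function.comp_apply]
    exact integral_comp_shearMap hij Q (fun x => ‖G x‖ ^ 2)
  rw [hcomp]
  refine (hfibP G' hG's hn').trans ?_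
  rw [hL2]
  have hI : 0 ≤ Real.sqrt (∫ x, ‖G x‖ ^ 2) := Real.sqrt_nonneg _
  have h0 : 0 ≤ Real.sqrt (∑' k, μ k ^ 2 * ‖mFourierCoeff G' k‖ ^ 2) + A * Real.sqrt (∫ x, ‖G x‖ ^ 2) := by positivity
  have hle : Real.sqrt (∑' k, μ k ^ 2 * ‖mFourierCoeff G' k‖ ^ 2) + A * Real.sqrt (∫ x, ‖G x‖ ^ 2) ≤
      Real.sqrt (∑' k, μ k ^ 2 * ‖mFourierCoeff G k‖ ^ 2) + (A + AQ) * Real.sqrt (∫ x, ‖G x‖ ^ 2) := by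
    have := hleak; simp only [hG'] at this ⊢; linarith
  have := pow_le_pow_left₀ h0 hle 2
  linarith

/-- **Factorised shear, leakage from first-order data.**  As `fibre_estimate_of_factor`, with the residual leakage
discharged by `…SpectralLeakage.sqrt_tsum_symbol_sq_comp_shearMap_fibre_le`: `A_Q = Σ_q ω(q)‖𝓕(x ↦ e^{−2πinQ(x_j)})(q)‖`
for a modulus `ω` of the old symbol `μ` (`|μ(k) − μ(k−q)| ≤ ω(q)`), provided that spectral moment is summable.
[cite: Grafakos2014, Prop. 3.1.2 (5) and Prop. 3.2.7 (3)] -/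
theorem fibre_estimate_of_factor_of_moduli {i j : Fin 2} (hij : i ≠ j) (P Q R : ShearProfile)
    (hR : ∀ y, R y = P y + Q y) (Ξ : UnitAddTorus (Fin 2) → ℂ) {m μ : (Fin 2 → ℤ) → ℝ} {Mμ : ℝ} (hμM : ∀ k, |μ k| ≤ Mμ)
    {n : ℤ} {A C : ℝ} (hA : 0 ≤ A)
    (hfibP : ∀ G' : UnitAddTorus (Fin 2) → ℂ, IsSmooth G' → (∀ k, mFourierCoeff G' k ≠ 0 → k i = n) →
      ∑' k, m k ^ 2 * ‖mFourierCoeff (fun x => Ξ x * G' (shearMap i j P x)) k‖ ^ 2 ≤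
        (Real.sqrt (∑' k, μ k ^ 2 * ‖mFourierCoeff G' k‖ ^ 2) + A * Real.sqrt (∫ x, ‖G' x‖ ^ 2)) ^ 2 +
          2 * C * ∫ x, ‖G' x‖ ^ 2)
    {ω : (Fin 2 → ℤ) → ℝ} (hω0 : ∀ q, 0 ≤ ω q) (hω : ∀ k q, |μ k - μ (k - q)| ≤ ω q)
    (hΘs : Summable fun q => ‖mFourierCoeff (fun x : UnitAddTorus (Fin 2) => twist Q n (x j)) q‖)
    (hωs : Summable fun q => ω q * ‖mFourierCoeff (fun x : UnitAddTorus (Fin 2) => twist Q n (x j)) q‖)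
    {G : UnitAddTorus (Fin 2) → ℂ} (hG : IsSmooth G) (hn : ∀ k, mFourierCoeff G k ≠ 0 → k i = n) :
    ∑' k, m k ^ 2 * ‖mFourierCoeff (fun x => Ξ x * G (shearMap i j R x)) k‖ ^ 2 ≤
      (Real.sqrt (∑' k, μ k ^ 2 * ‖mFourierCoeff G k‖ ^ 2) +
          (A + ∑' q, ω q * ‖mFourierCoeff (fun x : UnitAddTorus (Fin 2) => twist Q n (x j)) q‖) *
            Real.sqrt (∫ x, ‖G x‖ ^ 2)) ^ 2 +
        2 * C * ∫ x, ‖G x‖ ^ 2 :=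
  fibre_estimate_of_factor hij P Q R hR Ξ hA hfibP hG hn
    (sqrt_tsum_symbol_sq_comp_shearMap_fibre_le hG hn Q j hμM hω0 hω hΘs hωs)

/-! ## §4 The two cases glued along an envelope radius -/

/-- **The per-fibre estimate for the true profile, split along a radius `R₀`.**  Suppose `|m| ≤ 1`, `‖Ξ‖ ≤ 1` (continuous),
`R = P + Q`, and: (i) on the fibres `|n| ≥ R₀` the old symbol is `≡ 1`; (ii) on the fibres `|n| < R₀` the estimate holds for
`Φ_P` with constants `(A, C)` and the residual shear `Φ_Q` leaks at most `A_Q`.  Then the estimate holds for `Φ_R` on EVERY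
fibre with constants `(A + A_Q, C)` — the hypothesis `hfib` of `…K1Slot.sqrt_tsum_symbol_sq_family_step_H/_V`
(`Ξ = X(x_j) + Z(x_j)`). [cite: Grafakos2014, Prop. 3.1.2 (5) and Prop. 3.2.7 (3)] -/
theorem fibre_estimate_of_split {i j : Fin 2} (hij : i ≠ j) (P Q R : ShearProfile) (hR : ∀ y, R y = P y + Q y)
    {Ξ : UnitAddTorus (Fin 2) → ℂ} (hΞ : Continuous Ξ) (hΞ1 : ∀ x, ‖Ξ x‖ ≤ 1)
    {m μ : (Fin 2 → ℤ) → ℝ} (hm1 : ∀ k, |m k| ≤ 1) (R₀ : ℝ)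
    (hone : ∀ n : ℤ, R₀ ≤ |(n : ℝ)| → ∀ k : Fin 2 → ℤ, k i = n → μ k = 1)
    {A AQ C : ℝ} (hA : 0 ≤ A) (hAQ : 0 ≤ AQ) (hC : 0 ≤ C)
    (hfibP : ∀ n : ℤ, |(n : ℝ)| < R₀ → ∀ G' : UnitAddTorus (Fin 2) → ℂ, IsSmooth G' →
      (∀ k, mFourierCoeff G' k ≠ 0 → k i = n) →
      ∑' k, m k ^ 2 * ‖mFourierCoeff (fun x => Ξ x * G' (shearMap i j P x)) k‖ ^ 2 ≤
        (Real.sqrt (∑' k, μ k ^ 2 * ‖mFourierCoeff G' k‖ ^ 2) + A * Real.sqrt (∫ x, ‖G' x‖ ^ 2)) ^ 2 +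
          2 * C * ∫ x, ‖G' x‖ ^ 2)
    (hleak : ∀ n : ℤ, |(n : ℝ)| < R₀ → ∀ G : UnitAddTorus (Fin 2) → ℂ, IsSmooth G →
      (∀ k, mFourierCoeff G k ≠ 0 → k i = n) →
      Real.sqrt (∑' k, μ k ^ 2 * ‖mFourierCoeff (G ∘ shearMap i j Q) k‖ ^ 2) ≤
        Real.sqrt (∑' k, μ k ^ 2 * ‖mFourierCoeff G k‖ ^ 2) + AQ * Real.sqrt (∫ x, ‖G x‖ ^ 2))
    (n : ℤ) (G : UnitAddTorus (Fin 2) → ℂ) (hG : IsSmooth G) (hn : ∀ k, mFourierCoeff G k ≠ 0 → k i = n) :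
    ∑' k, m k ^ 2 * ‖mFourierCoeff (fun x => Ξ x * G (shearMap i j R x)) k‖ ^ 2 ≤
      (Real.sqrt (∑' k, μ k ^ 2 * ‖mFourierCoeff G k‖ ^ 2) + (A + AQ) * Real.sqrt (∫ x, ‖G x‖ ^ 2)) ^ 2 +
        2 * C * ∫ x, ‖G x‖ ^ 2 := by
  rcases le_or_gt R₀ |(n : ℝ)| with hR₀ | hR₀
  · exact fibre_estimate_of_symbol_eq_one hij R hΞ hΞ1 hm1 (hone n hR₀) (add_nonneg hA hAQ) hC hG hn
  · exact fibre_estimate_of_factor hij P Q R hR Ξ hA (hfibP n hR₀) hG hn (hleak n hR₀ G hG hn)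

end Summit.AnomalousDissipation.AnomalousDissipation.Theorems.SawtoothPulseCascade.K1Ledger
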